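import Summits.KontsevichZagierPeriods.KontsevichZagierPeriods.Theses.UnfoldedStokes
import Summits.KontsevichZagierPeriods.KontsevichZagierPeriods.Theorems.PlanarAreas.Negative.WindowInvariant
import Literature.NumberTheory.Transcendental.SemialgebraicMonotonicityProofs
import Literature.NumberTheory.Transcendental.KZSubcalculusInvariants
import Literature.NumberTheory.Transcendental.KZBallPeelingAux
import Summits.KontsevichZagierPeriods.KontsevichZagierPeriods.Theorems.CompleteModGammaSector.Negative.CdfNewtonLeibnizZero

/-!
# `CubeKernelStep` (stmt-KontsevichZagierPeriods-17854) — negative side III: the second-layer window invariant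

cdisprove (refuter) support for the crux `CubeKernelStep` of route `KontsevichZagierPeriods/UnfoldedStokes`.
The invariant behind `Negative/StepRule2.lean` (`cubeKernelStep_false_without_changeOfVariables`:
the step `d = 1 → 2` FAILS in the calculus without rule (2), even when every representation of
dimension `≤ 1` is declared a relation).

SECOND-LAYER WINDOW VALUES `Λ²ₑ := KZ.restrictedEval (win₂ e)`: integrate each generator of dimension
`≥ 2` over `domain ∩ {x₀ < e}`, kill dimensions `0` AND `1`. Along the enlarged rule-(2)-free
sub-calculus

  `rulesOneThreeLow = closure ((1a) ∪ (1b) ∪ (3) ∪ {[r] : dim r ≤ 1})`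

the function `e ↦ Λ²ₑ(c)` has, off a finite set, a derivative on `(0,1)` given by a `ℚ`-SEMIALGEBRAIC
function (`hasSADeriv_of_mem`):
* rules (1a), (1b) and the low-dimensional generators do not move `Λ²` at all;
* a Newton–Leibniz move `n + 3 → n + 2` preserves `Λ²` (the window rides on the base; tree
  `PlanarAreas.Negative.restrictedEval_win_nl_succ`), a move `1 → 0` is invisible;
* a Newton–Leibniz move `2 → 1` has the DEFECT `e ↦ ∫_{τ ∩ {x₀<e}} g` (`τ ⊆ ℝ¹`, `g` the base
  integrand): its derivative is the extension by zero of `g`, a `ℚ`-semialgebraic function of one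
  variable, at every continuity point — and by the monotonicity theorem (tree,
  `semialgebraic_monotonicity_holds`) all but finitely many points are continuity points.
For a continuous `2`-cube representation `[[0,1]², h]` the derivative of `Λ²` is the PERIOD FUNCTION
`V(s) = ∫₀¹ h(s,x) dx`: chains of additivity + Newton–Leibniz (+ anything of dimension `≤ 1`) only reach
square kernel elements whose first marginal is semialgebraic off finitely many points.
[Kontsevich–Zagier 2001, §1.2; van den Dries 1998, Ch. 3 (1.2); Ayoub 2015, Rem. 1.2]
-/

noncomputable section

namespace Summit.KontsevichZagierPeriods.UnfoldedStokes.CubeKernelStepNegative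

open MeasureTheory Set Filter Topology
open Literature.NumberTheory.Transcendental
open Literature.NumberTheory.Transcendental.KZ
open Literature.ModelTheory.ExponentialFields (IsSemialgebraic)
open Summit.KontsevichZagierPeriods.PlanarAreas.Negative (win measurableSet_win restrictedEval_win_nl_succ)
open Summit.KontsevichZagierPeriods.CompleteModGammaSectorNegative (fin_one_eq)

/-! ### Second-layer windows -/

/-- Second-layer windows on the first coordinate: `{x | x 0 < e}` in dimension `≥ 2`, nothing in
dimensions `0` and `1`. -/
def win₂ (e : ℝ) : (n : ℕ) → Set (Fin n → ℝ)
  | 0 => ∅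
  | 1 => ∅
  | _ + 2 => {x | x 0 < e}

/-- No window in dimension `0`. [folklore] -/
@[simp] theorem win₂_zero (e : ℝ) : win₂ e 0 = ∅ := rfl
/-- No window in dimension `1`. [folklore] -/
@[simp] theorem win₂_one (e : ℝ) : win₂ e 1 = ∅ := rfl
/-- In dimension `≥ 2` the window is the first-coordinate window `PlanarAreas.Negative.win`. [folklore] -/
theorem win₂_add_two (e : ℝ) (n : ℕ) : win₂ e (n + 2) = win e (n + 1 + 1) := rfl

/-- The windows are measurable. [folklore] -/
theorem measurableSet_win₂ (e : ℝ) : ∀ n, MeasurableSet (win₂ e n)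
  | 0 => MeasurableSet.empty
  | 1 => MeasurableSet.empty
  | _ + 2 => measurableSet_lt (measurable_pi_apply 0) measurable_const

/-- `Λ²` kills dimension `0`. [folklore] -/
theorem restrictedEval_win₂_of_zero (e : ℝ) (r : IntegralRep 0) :
    restrictedEval (win₂ e) (of r) = 0 := by
  simp [restrictedEval_of]

/-- `Λ²` kills dimension `1`. [folklore] -/
theorem restrictedEval_win₂_of_one (e : ℝ) (r : IntegralRep 1) :
    restrictedEval (win₂ e) (of r) = 0 := by
  simp [restrictedEval_of]

/-- In dimension `≥ 2`, `Λ²` is the first-coordinate window value. [folklore] -/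
theorem restrictedEval_win₂_of_add_two (e : ℝ) {n : ℕ} (r : IntegralRep (n + 2)) :
    restrictedEval (win₂ e) (of r) = restrictedEval (win e) (of r) := by
  rw [restrictedEval_of, restrictedEval_of]
  rfl

/-! ### The defect class: a `ℚ`-semialgebraic derivative off a finite set -/

/-- The open unit window `(0,1) ⊆ ℝ¹`. -/
def openWindow : Set (Fin 1 → ℝ) := {z | z 0 ∈ Ioo (0:ℝ) 1}

/-- The open unit window is `ℚ`-semialgebraic. [folklore] -/
theorem isSemialgebraic_openWindow : IsSemialgebraic ℚ openWindow := by
  simpa [openWindow] using BallPeeling.isSemialgebraic_Ioo₁ 0 1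

/-- **The defect class.** `Φ : ℝ → ℝ` has, off a finite set of exceptions, a derivative at every
point of `(0,1)`, given there by ONE `ℚ`-semialgebraic function of one variable. -/
def HasSADeriv (Φ : ℝ → ℝ) : Prop :=
  ∃ (s : Finset ℝ) (g : ℝ → ℝ), IsSemialgebraicFunOn ℚ openWindow (fun z => g (z 0)) ∧
    ∀ e ∈ Ioo (0:ℝ) 1, e ∉ s → HasDerivAt Φ (g e) e

/-- The zero function is `ℚ`-semialgebraic on the window. [folklore] -/
theorem isSemialgebraicFunOn_zero_openWindow :
    IsSemialgebraicFunOn ℚ openWindow (fun _ : Fin 1 → ℝ => (0:ℝ)) :=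
  (isSemialgebraicFunOn_aeval isSemialgebraic_openWindow (0 : MvPolynomial (Fin 1) ℚ)).congr
    fun z _ => by simp

/-- The identically-zero function is in the class. [folklore] -/
theorem hasSADeriv_of_eq_zero {Φ : ℝ → ℝ} (h : ∀ e, Φ e = 0) : HasSADeriv Φ := by
  refine ⟨∅, fun _ => 0, isSemialgebraicFunOn_zero_openWindow, fun e _ _ => ?_⟩
  have hΦ : Φ = fun _ => 0 := funext h
  rw [hΦ]
  exact hasDerivAt_const e 0

/-- The class is closed under addition (Tarski–Seidenberg for the sum; union of the exceptional
sets). [folklore] -/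
theorem HasSADeriv.add {Φ Ψ : ℝ → ℝ} (hΦ : HasSADeriv Φ) (hΨ : HasSADeriv Ψ) :
    HasSADeriv (Φ + Ψ) := by
  classical
  obtain ⟨s, g, hg, hd⟩ := hΦ
  obtain ⟨s', g', hg', hd'⟩ := hΨ
  refine ⟨s ∪ s', fun e => g e + g' e, IsSemialgebraicFunOn.add_holds hg hg', fun e he hes => ?_⟩
  rw [Finset.mem_union, not_or] at hes
  exact (hd e he hes.1).add (hd' e he hes.2)

/-- The class is closed under negation. [folklore] -/
theorem HasSADeriv.neg {Φ : ℝ → ℝ} (hΦ : HasSADeriv Φ) : HasSADeriv (-Φ) := by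
  obtain ⟨s, g, hg, hd⟩ := hΦ
  exact ⟨s, fun e => -g e, hg.neg, fun e he hes => (hd e he hes).neg⟩

/-! ### One-variable `ℚ`-semialgebraic functions are continuous off a finite set -/

/-- **Piecewise continuity** (from the monotonicity theorem, tree `semialgebraic_monotonicity_holds`):
a function with `ℚ`-semialgebraic graph over `(a, b)` is continuous at all but finitely many points
of `(a, b)`. [cite: Dries1998, Ch. 3 (1.2) Monotonicity Theorem] -/
theorem exists_finset_continuousAt {a b : ℝ} (hab : a < b) {f : ℝ → ℝ}
    (hf : IsSemialgebraicFunOn ℚ {t : Fin 1 → ℝ | t 0 ∈ Ioo a b} (fun t => f (t 0))) :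
    ∃ s : Finset ℝ, ∀ x ∈ Ioo a b, x ∉ s → ContinuousAt f x := by
  classical
  obtain ⟨s, -, hcell⟩ := semialgebraic_monotonicity_holds a b f hab hf
  refine ⟨s, fun x hx hxs => ?_⟩
  -- the complementary interval `(u, v)` of `s` containing `x`
  set L : Finset ℝ := insert a (s.filter (· < x)) with hL
  set U : Finset ℝ := insert b (s.filter (x < ·)) with hU
  have hLne : L.Nonempty := ⟨a, Finset.mem_insert_self _ _⟩
  have hUne : U.Nonempty := ⟨b, Finset.mem_insert_self _ _⟩
  have hmemL : ∀ y ∈ L, y < x := fun y hy => by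
    rcases Finset.mem_insert.mp hy with rfl | hy
    · exact hx.1
    · exact (Finset.mem_filter.mp hy).2
  have hmemU : ∀ y ∈ U, x < y := fun y hy => by
    rcases Finset.mem_insert.mp hy with rfl | hy
    · exact hx.2
    · exact (Finset.mem_filter.mp hy).2
  have hu_lt : L.max' hLne < x := hmemL _ (Finset.max'_mem L hLne)
  have hx_lt : x < U.min' hUne := hmemU _ (Finset.min'_mem U hUne)
  have hu : L.max' hLne = a ∨ L.max' hLne ∈ s := by
    rcases Finset.mem_insert.mp (Finset.max'_mem L hLne) with h | h
    · exact Or.inl h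
    · exact Or.inr (Finset.mem_filter.mp h).1
  have hv : U.min' hUne = b ∨ U.min' hUne ∈ s := by
    rcases Finset.mem_insert.mp (Finset.min'_mem U hUne) with h | h
    · exact Or.inl h
    · exact Or.inr (Finset.mem_filter.mp h).1
  have hno : ∀ y ∈ s, y ∉ Ioo (L.max' hLne) (U.min' hUne) := by
    intro y hy hyuv
    rcases lt_trichotomy y x with h | h | h
    · have : y ≤ L.max' hLne :=
        Finset.le_max' L y (Finset.mem_insert_of_mem (Finset.mem_filter.mpr ⟨hy, h⟩))
      linarith [hyuv.1]
    · exact hxs (h ▸ hy)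
    · have : U.min' hUne ≤ y :=
        Finset.min'_le U y (Finset.mem_insert_of_mem (Finset.mem_filter.mpr ⟨hy, h⟩))
      linarith [hyuv.2]
  have hnhds : Ioo (L.max' hLne) (U.min' hUne) ∈ 𝓝 x := Ioo_mem_nhds hu_lt hx_lt
  rcases hcell _ _ (hu_lt.trans hx_lt) hu hv hno with ⟨C, hC⟩ | ⟨-, hcont⟩
  · exact (continuousAt_const (y := C)).congr_of_eventuallyEq (Filter.eventuallyEq_of_mem hnhds hC)
  · exact hcont.continuousAt hnhds

/-! ### The defect of a Newton–Leibniz move `2 → 1` -/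

section Defect

variable (r' : IntegralRep 1)

/-- The base domain `τ ⊆ ℝ¹` read in `ℝ`. -/
def baseLine : Set ℝ := {t | (fun _ : Fin 1 => t) ∈ r'.domain}

/-- The base integrand read in `ℝ` and EXTENDED BY ZERO off `τ`. -/
def baseFun (t : ℝ) : ℝ := (baseLine r').indicator (fun t => r'.integrand (fun _ : Fin 1 => t)) t

/-- `τ` read in `ℝ` is measurable. [folklore] -/
theorem measurableSet_baseLine : MeasurableSet (baseLine r') :=
  (IntegralRep.measurableSet_domain_holds r').preimage (continuous_pi fun _ => continuous_id).measurable

/-- **The extension by zero is `ℚ`-semialgebraic** (its graph is the graph of the integrand over `τ`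
together with `τᶜ × {0}`). [cite: BochnakCosteRoy1998, Def. 2.2.5] -/
theorem baseFun_isSemialgebraicFunOn :
    IsSemialgebraicFunOn ℚ (univ : Set (Fin 1 → ℝ)) (fun z => baseFun r' (z 0)) := by
  rw [isSemialgebraicFunOn_iff]
  have hG := isSemialgebraicFunOn_iff.mp r'.isSemialgebraicFunOn_integrand
  have hC : IsSemialgebraic ℚ {w : Fin (1 + 1) → ℝ | Fin.init w ∈ r'.domainᶜ} :=
    r'.isSemialgebraic_domain.compl.setOf_init_mem
  have hZ : IsSemialgebraic ℚ {w : Fin (1 + 1) → ℝ | w (Fin.last 1) = 0} := by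
    simpa using Literature.ModelTheory.ExponentialFields.isSemialgebraic_setOf_eval_eq_zero (k := ℚ)
      (R := ℝ) (MvPolynomial.X (Fin.last 1) : MvPolynomial (Fin (1 + 1)) ℚ)
  convert hG.union (hC.inter hZ) using 1
  ext w
  simp only [mem_setOf_eq, mem_univ, true_and, mem_union, mem_inter_iff, mem_compl_iff]
  have hw : (Fin.init w : Fin 1 → ℝ) = fun _ => w 0 := fin_one_eq _
  show w (Fin.last 1) = baseFun r' (w 0) ↔ _
  by_cases hmem : (fun _ : Fin 1 => w 0) ∈ r'.domain
  · have hmem' : Fin.init w ∈ r'.domain := by rw [hw]; exact hmem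
    have hb : baseFun r' (w 0) = r'.integrand (Fin.init w) := by
      rw [baseFun, indicator_of_mem (show w 0 ∈ baseLine r' from hmem), hw]
    rw [hb]
    constructor
    · intro h
      exact Or.inl ⟨hmem', h⟩
    · rintro (⟨-, h⟩ | ⟨hc, -⟩)
      · exact h
      · exact absurd hmem' hc
  · have hmem' : Fin.init w ∉ r'.domain := by rw [hw]; exact hmem
    have hb : baseFun r' (w 0) = 0 := by
      rw [baseFun, indicator_of_notMem (show w 0 ∉ baseLine r' from hmem)]
    rw [hb]
    constructor
    · intro h
      exact Or.inr ⟨hmem', h⟩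
    · rintro (⟨hc, -⟩ | ⟨-, h⟩)
      · exact absurd hc hmem'
      · exact h

/-- The extension by zero is continuous off a finite subset of `(−1, 2) ⊇ [0,1]`. [folklore] -/
theorem exists_finset_continuousAt_baseFun :
    ∃ s : Finset ℝ, ∀ x ∈ Ioo (-1:ℝ) 2, x ∉ s → ContinuousAt (baseFun r') x := by
  refine exists_finset_continuousAt (by norm_num) ?_
  have h := (baseFun_isSemialgebraicFunOn r').mono (subset_univ _) (BallPeeling.isSemialgebraic_Ioo₁ (-1) 2)
  simpa using h

/-- The extension by zero is integrable on `ℝ` (the integrand is absolutely integrable on `τ`).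
[folklore] -/
theorem integrable_baseFun : Integrable (baseFun r') := by
  set E := MeasurableEquiv.funUnique (Fin 1) ℝ with hE
  have hE_apply : ∀ z : Fin 1 → ℝ, E z = z 0 := fun z => rfl
  have hmp : MeasurePreserving E volume volume := volume_preserving_funUnique (Fin 1) ℝ
  have hpre : E ⁻¹' (baseLine r') = r'.domain := by
    ext z
    rw [mem_preimage, hE_apply, baseLine, mem_setOf_eq, ← fin_one_eq z]
  have h1 : IntegrableOn ((fun t => r'.integrand (fun _ : Fin 1 => t)) ∘ E) (E ⁻¹' baseLine r') := by
    rw [hpre]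
    refine r'.integrableOn.congr_fun (fun z _ => ?_) (IntegralRep.measurableSet_domain_holds r')
    show r'.integrand z = r'.integrand (fun _ => E z)
    rw [hE_apply, ← fin_one_eq z]
  have h2 : IntegrableOn (fun t => r'.integrand (fun _ : Fin 1 => t)) (baseLine r') :=
    (hmp.integrableOn_comp_preimage E.measurableEmbedding).mp h1
  exact (integrable_indicator_iff (measurableSet_baseLine r')).mpr h2

/-- **The window value of a one-dimensional representation through the extension by zero**:
`Λₑ [r'] = ∫_{τ ∩ {x₀ < e}} g = ∫_{(−∞, e)} g̃`. [folklore] -/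
theorem restrictedEval_win_eq_integral_baseFun (e : ℝ) :
    restrictedEval (win e) (of r') = ∫ t in Iio e, baseFun r' t := by
  rw [restrictedEval_of]
  set E := MeasurableEquiv.funUnique (Fin 1) ℝ with hE
  have hE_apply : ∀ z : Fin 1 → ℝ, E z = z 0 := fun z => rfl
  have hmp : MeasurePreserving E volume volume := volume_preserving_funUnique (Fin 1) ℝ
  have hset : r'.domain ∩ win e 1 = E ⁻¹' (Iio e ∩ baseLine r') := by
    ext z
    rw [mem_inter_iff, mem_preimage, mem_inter_iff, hE_apply, baseLine, mem_setOf_eq,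
      ← fin_one_eq z, mem_Iio]
    exact ⟨fun h => ⟨h.2, h.1⟩, fun h => ⟨h.2, h.1⟩⟩
  have hmeas : MeasurableSet (E ⁻¹' (Iio e ∩ baseLine r')) :=
    (measurableSet_Iio.inter (measurableSet_baseLine r')).preimage E.measurable
  rw [hset]
  have hcongr : ∫ x in E ⁻¹' (Iio e ∩ baseLine r'), r'.integrand x =
      ∫ x in E ⁻¹' (Iio e ∩ baseLine r'), (fun t => r'.integrand (fun _ : Fin 1 => t)) (E x) :=
    setIntegral_congr_fun hmeas fun z _ => by
      show r'.integrand z = r'.integrand (fun _ => E z)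
      rw [hE_apply, ← fin_one_eq z]
  rw [hcongr, hmp.setIntegral_preimage_emb E.measurableEmbedding (fun t => r'.integrand fun _ => t)
    (Iio e ∩ baseLine r')]
  unfold baseFun
  exact (setIntegral_indicator (measurableSet_baseLine r')).symm

/-- **FTC for the running integral** `u ↦ ∫_{(−∞,u)} g` of an integrable `g` at a continuity point.
[folklore] -/
theorem hasDerivAt_integral_Iio {g : ℝ → ℝ} (hg : Integrable g) {e : ℝ} (hc : ContinuousAt g e) :
    HasDerivAt (fun u => ∫ t in Iio u, g t) (g e) e := by
  have heq : (fun u => ∫ t in Iio u, g t) = fun u => (∫ t in Iic 0, g t) + ∫ t in (0:ℝ)..u, g t := by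
    funext u
    rw [← integral_Iic_eq_integral_Iio, ← intervalIntegral.integral_Iic_sub_Iic hg.integrableOn
      hg.integrableOn]
    ring
  rw [heq]
  exact (intervalIntegral.integral_hasDerivAt_right (hg.intervalIntegrable)
    hg.aestronglyMeasurable.stronglyMeasurableAtFilter hc).const_add _

/-- **THE DEFECT LEMMA.** The window values `e ↦ Λₑ [r']` of a one-dimensional representation are
in the defect class: derivative `g̃(e)` (the base integrand extended by zero, `ℚ`-semialgebraic) at
every `e ∈ (0,1)` off the finitely many discontinuities of `g̃`. [cite: Dries1998, Ch. 3 (1.2)] -/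
theorem hasSADeriv_restrictedEval_win_one : HasSADeriv (fun e => restrictedEval (win e) (of r')) := by
  classical
  obtain ⟨s, hs⟩ := exists_finset_continuousAt_baseFun r'
  refine ⟨s, baseFun r', (baseFun_isSemialgebraicFunOn r').mono (subset_univ _)
    isSemialgebraic_openWindow, fun e he hes => ?_⟩
  have hfun : (fun e => restrictedEval (win e) (of r')) = fun e => ∫ t in Iio e, baseFun r' t :=
    funext (restrictedEval_win_eq_integral_baseFun r')
  rw [hfun]
  exact hasDerivAt_integral_Iio (integrable_baseFun r')
    (hs e ⟨by linarith [he.1], by linarith [he.2]⟩ hes)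

end Defect

/-! ### The enlarged rule-(2)-free sub-calculus and the invariant -/

/-- ALL representations of dimension `≤ 1`, declared relations (so that the interval layer of the
cube kernel — and much more — is granted for free). -/
def lowDim : Set FormalRep := {c | ∃ (n : ℕ) (r : IntegralRep n), n ≤ 1 ∧ c = of r}

/-- **The enlarged rule-(2)-free sub-calculus**: rules (1a), (1b), (3) together with every
representation of dimension `≤ 1`. [cite: KontsevichZagier2001, §1.2] -/
def rulesOneThreeLow : AddSubgroup FormalRep :=
  AddSubgroup.closure (domainAddRel ∪ integrandAddRel ∪ newtonLeibnizRel ∪ lowDim)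

/-- Every representation of dimension `≤ 1` lies in the enlarged sub-calculus. [folklore] -/
theorem of_mem_rulesOneThreeLow_of_le_one {n : ℕ} (hn : n ≤ 1) (r : IntegralRep n) :
    of r ∈ rulesOneThreeLow :=
  AddSubgroup.subset_closure (Or.inr ⟨n, r, hn, rfl⟩)

/-- Rule (3) lies in the enlarged sub-calculus. [folklore] -/
theorem newtonLeibnizRel_subset_rulesOneThreeLow : newtonLeibnizRel ⊆ rulesOneThreeLow :=
  fun _ hc => AddSubgroup.subset_closure (Or.inl (Or.inr hc))

/-- Rules (1a), (1b) lie in the enlarged sub-calculus. [folklore] -/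
theorem closure_add_le_rulesOneThreeLow :
    AddSubgroup.closure (domainAddRel ∪ integrandAddRel) ≤ rulesOneThreeLow :=
  AddSubgroup.closure_mono fun _ hc => Or.inl (Or.inl hc)

/-- `Λ²` kills the low-dimensional generators. [folklore] -/
theorem restrictedEval_win₂_eq_zero_of_mem_lowDim {c : FormalRep} (hc : c ∈ lowDim) (e : ℝ) :
    restrictedEval (win₂ e) c = 0 := by
  obtain ⟨n, r, hn, rfl⟩ := hc
  match n, r, hn with
  | 0, r, _ => exact restrictedEval_win₂_of_zero e r
  | 1, r, _ => exact restrictedEval_win₂_of_one e r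
  | n + 2, _, hn => omega

/-- **`Λ²` along a Newton–Leibniz move**: invisible for `1 → 0`, preserved for `n + 3 → n + 2`, and
for `2 → 1` the defect of `hasSADeriv_restrictedEval_win_one`. [cite: KontsevichZagier2001, §1.2 rule (3)] -/
theorem hasSADeriv_of_mem_newtonLeibnizRel {c : FormalRep} (hc : c ∈ newtonLeibnizRel) :
    HasSADeriv (fun e => restrictedEval (win₂ e) c) := by
  obtain ⟨n, r, r', a, b, F, -, -, -, hab, hdom, hcont, hderiv, hr', rfl⟩ := hc
  cases n with
  | zero =>
    exact hasSADeriv_of_eq_zero fun e => by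
      rw [map_sub, restrictedEval_win₂_of_one, restrictedEval_win₂_of_zero, sub_zero]
  | succ n =>
    cases n with
    | zero =>
      have hred : (fun e => restrictedEval (win₂ e) (of r - of r')) =
          fun e => restrictedEval (win e) (of r') := by
        funext e
        have h := restrictedEval_win_nl_succ e r r' a b F hab hdom hcont hderiv hr'
        rw [map_sub, sub_eq_zero] at h
        rw [map_sub, restrictedEval_win₂_of_one, sub_zero, restrictedEval_win₂_of_add_two, h]
      rw [hred]
      exact hasSADeriv_restrictedEval_win_one r'
    | succ k =>
      exact hasSADeriv_of_eq_zero fun e => by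
        rw [map_sub, restrictedEval_win₂_of_add_two, restrictedEval_win₂_of_add_two, ← map_sub]
        exact restrictedEval_win_nl_succ e r r' a b F hab hdom hcont hderiv hr'

/-- **THE INVARIANT.** Along the enlarged rule-(2)-free sub-calculus, the second-layer window values
`e ↦ Λ²ₑ(c)` have, off a finite set, a `ℚ`-semialgebraic derivative on `(0,1)`.
[cite: KontsevichZagier2001, §1.2] [cite: Dries1998, Ch. 3 (1.2)] -/
theorem hasSADeriv_of_mem {c : FormalRep} (hc : c ∈ rulesOneThreeLow) :
    HasSADeriv (fun e => restrictedEval (win₂ e) c) := by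
  refine AddSubgroup.closure_induction (p := fun x _ => HasSADeriv (fun e => restrictedEval (win₂ e) x))
    (fun x hx => ?_) ?_ (fun x y _ _ hx hy => ?_) (fun x _ hx => ?_) hc
  · rcases hx with ((hx | hx) | hx) | hx
    · exact hasSADeriv_of_eq_zero fun e =>
        restrictedEval_eq_zero_of_mem_domainAddRel _ (measurableSet_win₂ e) hx
    · exact hasSADeriv_of_eq_zero fun e =>
        restrictedEval_eq_zero_of_mem_integrandAddRel _ (measurableSet_win₂ e) hx
    · exact hasSADeriv_of_mem_newtonLeibnizRel hx
    · exact hasSADeriv_of_eq_zero (restrictedEval_win₂_eq_zero_of_mem_lowDim hx)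
  · exact hasSADeriv_of_eq_zero fun e => by simp
  · have h : (fun e => restrictedEval (win₂ e) (x + y)) =
        (fun e => restrictedEval (win₂ e) x) + fun e => restrictedEval (win₂ e) y :=
      funext fun e => by simp
    rw [h]
    exact hx.add hy
  · have h : (fun e => restrictedEval (win₂ e) (-x)) = -fun e => restrictedEval (win₂ e) x :=
      funext fun e => by simp
    rw [h]
    exact hx.neg

end Summit.KontsevichZagierPeriods.UnfoldedStokes.CubeKernelStepNegative

end
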